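import Literature.NumberTheory.LFunctions.DirichletLTruncationPackedWrappers
import Literature.NumberTheory.LFunctions.NoRealZeroTruncationPacked13340F
import Literature.NumberTheory.LFunctions.NoRealZeroTruncationPacked13340G1
import Literature.NumberTheory.LFunctions.NoRealZeroTruncationPacked13340G2a
import Literature.NumberTheory.LFunctions.NoRealZeroTruncationPacked13340G2b
import Literature.NumberTheory.LFunctions.NoRealZeroTruncationPacked13340G3a
import Literature.NumberTheory.LFunctions.NoRealZeroTruncationPacked13340G3b
import HarnessLib

/-!
# No real zero of `L(s, χ_13340)` on `(0, 1)`

The primitive quadratic character of conductor `13340 = 4·5·23·29` (even; a "wall" conductor of the Fekete–Pólya lane, with no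
summatory-positivity witness) has `L(σ, χ) ≠ 0` for `0 < σ < 1`, by the packed truncation certificate (Chua's ALGO 1, `K = 16`
periods, graded mesh of 67 cells on `[1/2, 1]`), assembled from the kernel-checked data files `…13340F/G1/G2a/G2b/G3a/G3b`.
[cite: Chua2005RealZeros, §2.2 ALGO 1]
-/

namespace Literature.NumberTheory.LFunctions

open LTruncationPacked FeketePolyaKernel

/-- **`L(σ, χ₁₃₃₄₀) ≠ 0` on `(0, 1)`** for the even primitive quadratic character of conductor `13340`. [cite: Chua2005RealZeros, §2.2 ALGO 1] -/
theorem noRealZeroEven_T_13340 : ∀ χ : DirichletCharacter ℂ 13340, χ.IsQuadratic → χ.IsPrimitive → χ.Even →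
    ∀ σ : ℝ, 0 < σ → σ < 1 → χ.LFunction σ ≠ 0 :=
  good_even_of_four_T [5, 23, 29] (by norm_num [List.Forall]) (by norm_num) (by norm_num) 72 15 40 11 128 16 2884 (by norm_num)
    [[(1024, 1), (1025, 1), (1026, 1), (1027, 1), (1028, 1), (1029, 1), (1030, 1), (1031, 1), (1032, 1), (1033, 1), (1034, 1), (1035, 2), (1037, 2), (1039, 2), (1041, 2), (1043, 2), (1045, 2), (1047, 2), (1049, 2), (1051, 2), (1053, 2), (1055, 2), (1057, 2)],
     [(1059, 2), (1061, 2), (1063, 2), (1065, 4), (1069, 4), (1073, 4), (1077, 4), (1081, 4), (1085, 4), (1089, 4), (1093, 4), (1097, 4)],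
     [(1101, 4), (1105, 4), (1109, 4), (1113, 4), (1117, 4), (1121, 4), (1125, 4), (1129, 8), (1137, 8), (1145, 8), (1153, 8)],
     [(1161, 8), (1169, 8), (1177, 8), (1185, 8), (1193, 8), (1201, 8), (1209, 8), (1217, 8), (1225, 8), (1233, 32), (1265, 32)],
     [(1297, 32), (1329, 32), (1361, 32), (1393, 32), (1425, 32), (1457, 64), (1521, 64), (1585, 64), (1649, 256), (1905, 256)]]
    (by simp)
    (Or.inr ⟨certTframe_13340, fun g hg => by
      simp only [List.mem_cons, List.mem_nil_iff, or_false] at hg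
      rcases hg with rfl | rfl | rfl | rfl | rfl
      · exact certTcells_13340_1
      · exact certTcells_13340_2a
      · exact certTcells_13340_2b
      · exact certTcells_13340_3a
      · exact certTcells_13340_3b⟩)

end Literature.NumberTheory.LFunctions
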